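import Mathlib
import Summits.Ventures.PercRepro2.Independence
import Summits.Ventures.PercRepro2.Harris
import Summits.Ventures.PercRepro2.HCov
import Summits.Ventures.PercRepro2.CutVertexPaths
import Summits.Ventures.PercRepro2.CutOneFarConn

/-!
# Two marks behind a cut vertex, I: THE GADGET GRAPH (blind cell PercRepro2, typer-1 g50)

Towards S3 §12.1 ((G5) of proofs/subclaims/S3-CLASSES.md) in the kernel — the «general split» behind
the two-far-mark cut-vertex classes.  With `v` a cut vertex between `L` and `Rt` (`CutVertex`,
`CutVertexPaths.lean`) and two marks `w₁, w₂ ∈ L ∪ {v}`, the connection pattern of `{v, w₁, w₂}`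
inside the left part is the random variable `pat ω : Fin 3 → Bool` (`0 : w₁ ↔ v`, `1 : w₂ ↔ v`,
`2 : w₁ ↔ w₂`, by left edges), and the GADGET GRAPH is the right side with the triangle
`{v, w₁}, {v, w₂}, {w₁, w₂}` glued at `v` (`gends`).  The configuration map `Ψ` (restriction to the
right edges, the pattern on the gadget edges) TRANSPORTS CONNECTIVITY between the marks
(**`conn_marks_iff`**: for marks among `w₁, w₂` and `Rt ∪ {v}`, `x ↔ z` in `G` iff `x ↔ z` in the
gadget graph at `Ψ ω`).  Part II (`CutTwoFarLaw.lean`) gives the law of `Ψ`, Part III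
(`CutTwoFar.lean`) the mixture formulas for the masses of the covariance form.  Own work; standard
axioms.
-/

namespace Summit.Ventures.PercRepro2

open CovForm CutVertexM9

namespace CutTwoFar

/-! ## The gadget graph -/

section Gadget

variable {V : Type*} {E : Type*}

/-- The edge type of the gadget graph: the right edges and the three gadget edges
(`0 : {v, w₁}`, `1 : {v, w₂}`, `2 : {w₁, w₂}`). -/
abbrev GEdge (side : E → Bool) : Type _ := {e : E // side e = false} ⊕ Fin 3

/-- The endpoints of the three gadget edges. -/
def gadgetEnds (v w₁ w₂ : V) : Fin 3 → Sym2 V := ![s(v, w₁), s(v, w₂), s(w₁, w₂)]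

/-- The gadget graph: the right edges as they are, and the triangle on `{v, w₁, w₂}`. -/
def gends (ends : E → Sym2 V) (side : E → Bool) (v w₁ w₂ : V) : GEdge side → Sym2 V
  | Sum.inl e => ends e.1
  | Sum.inr i => gadgetEnds v w₁ w₂ i

/-- The sides of the gadget graph: the gadget edges are the left side. -/
def gside (side : E → Bool) : GEdge side → Bool
  | Sum.inl _ => false
  | Sum.inr _ => true

open scoped Classical in
/-- The connection pattern of `{v, w₁, w₂}` inside the left part: which of the three pairs
`(w₁, v)`, `(w₂, v)`, `(w₁, w₂)` are joined by left edges. -/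
noncomputable def pat (ends : E → Sym2 V) (side : E → Bool) (v w₁ w₂ : V) (ω : Config E) :
    Fin 3 → Bool :=
  ![decide (Conn ends (CutVertexM9.restrict side true ω) w₁ v), decide (Conn ends (CutVertexM9.restrict side true ω) w₂ v),
    decide (Conn ends (CutVertexM9.restrict side true ω) w₁ w₂)]

/-- The configuration map: restriction to the right edges, and the pattern on the gadget edges. -/
noncomputable def Ψ (ends : E → Sym2 V) (side : E → Bool) (v w₁ w₂ : V) (ω : Config E) :
    Config (GEdge side)
  | Sum.inl e => ω e.1
  | Sum.inr i => pat ends side v w₁ w₂ ω i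

variable (ends : E → Sym2 V) (side : E → Bool) (v w₁ w₂ : V) (ω : Config E)

/-- `Ψ` on a right edge. -/
lemma Ψ_inl (e : {e : E // side e = false}) : Ψ ends side v w₁ w₂ ω (Sum.inl e) = ω e.1 := rfl

/-- `Ψ` on a gadget edge. -/
lemma Ψ_inr (i : Fin 3) : Ψ ends side v w₁ w₂ ω (Sum.inr i) = pat ends side v w₁ w₂ ω i := rfl

/-- The gadget edge `0` is open iff `w₁ ↔ v` by left edges. -/
lemma pat_zero_iff : pat ends side v w₁ w₂ ω 0 = true ↔ Conn ends (CutVertexM9.restrict side true ω) w₁ v := by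
  simp [pat]

/-- The gadget edge `1` is open iff `w₂ ↔ v` by left edges. -/
lemma pat_one_iff : pat ends side v w₁ w₂ ω 1 = true ↔ Conn ends (CutVertexM9.restrict side true ω) w₂ v := by
  simp [pat]

/-- The gadget edge `2` is open iff `w₁ ↔ w₂` by left edges. -/
lemma pat_two_iff : pat ends side v w₁ w₂ ω 2 = true ↔ Conn ends (CutVertexM9.restrict side true ω) w₁ w₂ := by
  simp [pat]

/-- The pattern only reads the left edges. -/
lemma pat_eq_of_agree {ω ω' : Config E} (hag : ∀ e, side e = true → ω e = ω' e) :
    pat ends side v w₁ w₂ ω = pat ends side v w₁ w₂ ω' := by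
  unfold pat
  rw [CutVertexM9.restrict_eq_of_agree hag]

/-- A connection carried along an equality of edge endpoints. -/
lemma conn_of_sym2_eq {ends : E → Sym2 V} {ω : Config E} {a b x y : V} (h : Conn ends ω a b)
    (hxy : s(a, b) = s(x, y)) : Conn ends ω x y := by
  rcases Sym2.eq_iff.1 hxy with ⟨rfl, rfl⟩ | ⟨rfl, rfl⟩
  · exact h
  · exact conn_symm h

/-- An open gadget edge joins two vertices that are connected (by left edges, hence in `ω`). -/
lemma conn_of_gadget_open {i : Fin 3} (hi : pat ends side v w₁ w₂ ω i = true) {x y : V}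
    (hxy : gadgetEnds v w₁ w₂ i = s(x, y)) : Conn ends ω x y := by
  fin_cases i
  · exact conn_of_sym2_eq (conn_symm (conn_mono (CutVertexM9.restrict_le side true ω)
      ((pat_zero_iff _ _ _ _ _ _).1 hi))) (by simpa [gadgetEnds] using hxy)
  · exact conn_of_sym2_eq (conn_symm (conn_mono (CutVertexM9.restrict_le side true ω)
      ((pat_one_iff _ _ _ _ _ _).1 hi))) (by simpa [gadgetEnds] using hxy)
  · exact conn_of_sym2_eq (conn_mono (CutVertexM9.restrict_le side true ω)
      ((pat_two_iff _ _ _ _ _ _).1 hi)) (by simpa [gadgetEnds] using hxy)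

/-- **Gadget ⇒ `G`**: a connection in the gadget graph is a connection in `G` (every open gadget
edge joins connected vertices; closure). -/
lemma conn_of_conn_gadget {x z : V}
    (hc : Conn (gends ends side v w₁ w₂) (Ψ ends side v w₁ w₂ ω) x z) : Conn ends ω x z := by
  refine mem_of_conn_of_closed (S := {y | Conn ends ω x y}) ?_ (conn_refl _ _ _) hc
  intro y hy y' hyy'
  obtain ⟨_, e', he', hends⟩ := openGraph_adj.1 hyy'
  refine conn_trans hy ?_
  rcases e' with e | i
  · exact conn_of_openAdj ⟨e.1, he', hends⟩
  · exact conn_of_gadget_open ends side v w₁ w₂ ω he' hends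

/-- A connection by right edges is a connection in the gadget graph. -/
lemma conn_gadget_of_conn_right {x z : V} (hc : Conn ends (CutVertexM9.restrict side false ω) x z) :
    Conn (gends ends side v w₁ w₂) (Ψ ends side v w₁ w₂ ω) x z := by
  refine mem_of_conn_of_closed
    (S := {y | Conn (gends ends side v w₁ w₂) (Ψ ends side v w₁ w₂ ω) x y}) ?_ (conn_refl _ _ _) hc
  intro y hy y' hyy'
  obtain ⟨_, e, he, hends⟩ := openGraph_adj.1 hyy'
  have hs : side e = false := by
    by_contra hs
    simp [CutVertexM9.restrict, hs] at he
  have he' : ω e = true := by simpa [CutVertexM9.restrict, hs] using he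
  exact conn_trans hy (conn_of_openAdj ⟨Sum.inl ⟨e, hs⟩, he', hends⟩)

/-- A connection by left edges between two of `v, w₁, w₂` is a connection in the gadget graph
(one gadget edge). -/
lemma conn_gadget_of_conn_left {x y : V} (hx : x = w₁ ∨ x = w₂ ∨ x = v)
    (hy : y = w₁ ∨ y = w₂ ∨ y = v) (hc : Conn ends (CutVertexM9.restrict side true ω) x y) :
    Conn (gends ends side v w₁ w₂) (Ψ ends side v w₁ w₂ ω) x y := by
  have e0 : Conn ends (CutVertexM9.restrict side true ω) w₁ v →
      Conn (gends ends side v w₁ w₂) (Ψ ends side v w₁ w₂ ω) w₁ v := fun h =>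
    conn_of_openAdj ⟨Sum.inr 0, (pat_zero_iff ends side v w₁ w₂ ω).2 h,
      by simp [gends, gadgetEnds, Sym2.eq_swap]⟩
  have e1 : Conn ends (CutVertexM9.restrict side true ω) w₂ v →
      Conn (gends ends side v w₁ w₂) (Ψ ends side v w₁ w₂ ω) w₂ v := fun h =>
    conn_of_openAdj ⟨Sum.inr 1, (pat_one_iff ends side v w₁ w₂ ω).2 h,
      by simp [gends, gadgetEnds, Sym2.eq_swap]⟩
  have e2 : Conn ends (CutVertexM9.restrict side true ω) w₁ w₂ →
      Conn (gends ends side v w₁ w₂) (Ψ ends side v w₁ w₂ ω) w₁ w₂ := fun h =>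
    conn_of_openAdj ⟨Sum.inr 2, (pat_two_iff ends side v w₁ w₂ ω).2 h,
      by simp [gends, gadgetEnds]⟩
  rcases hx with rfl | rfl | rfl <;> rcases hy with rfl | rfl | rfl
  · exact conn_refl _ _ _
  · exact e2 hc
  · exact e0 hc
  · exact conn_symm (e2 (conn_symm hc))
  · exact conn_refl _ _ _
  · exact e1 hc
  · exact conn_symm (e0 (conn_symm hc))
  · exact conn_symm (e1 (conn_symm hc))
  · exact conn_refl _ _ _

variable {ends side v w₁ w₂ ω} {L : Set V} {Rt : Set V}

/-- `G` ⇒ gadget for a left mark and a right vertex (or `v`). -/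
lemma conn_gadget_cross (h : CutVertex ends side L v Rt) (hw₁ : w₁ ∈ L ∨ w₁ = v)
    (hw₂ : w₂ ∈ L ∨ w₂ = v) {x z : V} (hx : x = w₁ ∨ x = w₂) (hz : z ∈ Rt ∨ z = v)
    (hc : Conn ends ω x z) :
    Conn (gends ends side v w₁ w₂) (Ψ ends side v w₁ w₂ ω) x z := by
  have hxL : x ∈ L ∨ x = v := by rcases hx with rfl | rfl <;> assumption
  obtain ⟨hxv, hzv⟩ := (conn_cross_iff h hxL hz ω).1 hc
  have h1 : Conn (gends ends side v w₁ w₂) (Ψ ends side v w₁ w₂ ω) x v :=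
    conn_gadget_of_conn_left ends side v w₁ w₂ ω (by rcases hx with rfl | rfl <;> simp)
      (Or.inr (Or.inr rfl)) ((conn_iff_restrict_left h hxL (Or.inr rfl) ω).1 hxv)
  have h2 : Conn (gends ends side v w₁ w₂) (Ψ ends side v w₁ w₂ ω) z v :=
    conn_gadget_of_conn_right ends side v w₁ w₂ ω
      ((conn_iff_restrict_right h hz (Or.inr rfl) ω).1 hzv)
  exact conn_trans h1 (conn_symm h2)

/-- **Connectivity between marks is the same in `G` and in the gadget graph**, for marks that are
`w₁`, `w₂`, or lie in `Rt ∪ {v}`. -/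
theorem conn_marks_iff (h : CutVertex ends side L v Rt) (hw₁ : w₁ ∈ L ∨ w₁ = v)
    (hw₂ : w₂ ∈ L ∨ w₂ = v) (ω : Config E) {x z : V} (hx : x = w₁ ∨ x = w₂ ∨ x ∈ Rt ∨ x = v)
    (hz : z = w₁ ∨ z = w₂ ∨ z ∈ Rt ∨ z = v) :
    Conn (gends ends side v w₁ w₂) (Ψ ends side v w₁ w₂ ω) x z ↔ Conn ends ω x z := by
  refine ⟨conn_of_conn_gadget ends side v w₁ w₂ ω, fun hc => ?_⟩
  have hx' : (x = w₁ ∨ x = w₂) ∨ (x ∈ Rt ∨ x = v) := by tauto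
  have hz' : (z = w₁ ∨ z = w₂) ∨ (z ∈ Rt ∨ z = v) := by tauto
  rcases hx' with hx | hx <;> rcases hz' with hz | hz
  · -- both left marks
    have hxL : x ∈ L ∨ x = v := by rcases hx with rfl | rfl <;> assumption
    have hzL : z ∈ L ∨ z = v := by rcases hz with rfl | rfl <;> assumption
    exact conn_gadget_of_conn_left ends side v w₁ w₂ ω (by rcases hx with rfl | rfl <;> simp)
      (by rcases hz with rfl | rfl <;> simp) ((conn_iff_restrict_left h hxL hzL ω).1 hc)
  · exact conn_gadget_cross h hw₁ hw₂ hx hz hc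
  · exact conn_symm (conn_gadget_cross h hw₁ hw₂ hz hx (conn_symm hc))
  · exact conn_gadget_of_conn_right ends side v w₁ w₂ ω
      ((conn_iff_restrict_right h hx hz ω).1 hc)

end Gadget

end CutTwoFar

end Summit.Ventures.PercRepro2
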